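import Literature.MathematicalPhysics.QuantumLattice.HubbardShiftedSliceCovariance
import HarnessLib

/-!
# Differences of the shifted free symbol: `|p_θ(k) - p_θ(k′)| ≤ βL² (|ω-ω′| + |ξ-ξ′|) / (|iω̃-ξ| |iω̃′-ξ′|)`

Topic `MathematicalPhysics/QuantumLattice`; companion of `HubbardShiftedSliceCovariance.lean` (the shifted free symbol
`p_θ(k) = βL² (i(ω+θ) + ξ)/((ω+θ)² + ξ²) = βL²/(-i(ω+θ) + ξ)`).  The weighted-Plancherel route to the `L¹` norms of the slice
propagators (`TorusFourierWeightedL1*`; cell gate-hubbard-kl, R0-SCOPE-2 §5.3 (W2)) prices decay in time and space by DISCRETE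
DIFFERENCES of the symbol in frequency and momentum; by the resolvent identity `1/z - 1/z′ = (z′ - z)/(zz′)` a difference of the
free symbol costs one more power of the denominator — `≲ 1/Λ` on a slice of scale `Λ` — times the step (`2π/β` in frequency,
`|∇ε|·2π/L` in momentum) (Benfatto–Giuliani–Mastropietro 2006, (2.36aa): discrete derivatives on the finite torus).

* `shiftedFreeSymbol_eq_div` — `p_θ(k) = βL² / (-i(ω+θ) + ξ)` (the denominator never vanishes for `|θ| < |ω|`, in particular for
  `|θ| ≤ π/(4β)`);
* **`norm_shiftedFreeSymbol_sub_le`** — for two labels `k, k′`: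
  `‖p_θ(k) - p_θ(k′)‖ ≤ βL² · (|ω - ω′| + |ξ - ξ′|) / (√((ω+θ)²+ξ²) · √((ω′+θ)²+ξ′²))`.

Everything is proved; no definitions, no named facts.

## Sources

G. Benfatto, A. Giuliani, V. Mastropietro, Ann. Henri Poincaré 7 (2006) 809–898, §2.1 (2.3), (2.36aa)
(`BenfattoGiulianiMastropietro2006`).
-/

noncomputable section

namespace Literature.MathematicalPhysics.QuantumLattice

open Literature.Probability.LatticeModels GrassmannAlgebra Finset

variable {L M : ℕ}

/-- The resolvent form of a complex number: `(ia + ξ)/(a² + ξ²) = 1/(-ia + ξ)` for real `a, ξ` not both zero. [folklore] -/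
private theorem resolvent_eq_inv {a ξ : ℝ} (h : a ^ 2 + ξ ^ 2 ≠ 0) :
    (Complex.I * (a : ℂ) + (ξ : ℂ)) / (((a ^ 2 + ξ ^ 2 : ℝ)) : ℂ) = 1 / (-Complex.I * (a : ℂ) + (ξ : ℂ)) := by
  have hz : (-Complex.I * (a : ℂ) + (ξ : ℂ)) ≠ 0 := by
    intro h0
    have hre := congrArg Complex.re h0
    have him := congrArg Complex.im h0
    simp at hre him
    apply h
    rw [hre, him]; ring
  have hprod : (-Complex.I * (a : ℂ) + (ξ : ℂ)) * (Complex.I * (a : ℂ) + (ξ : ℂ)) = (((a ^ 2 + ξ ^ 2 : ℝ)) : ℂ) := by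
    push_cast
    ring_nf
    rw [Complex.I_sq]
    ring
  rw [div_eq_div_iff (by exact_mod_cast h) hz, one_mul, ← hprod]
  ring

/-- The norm of `-ia + ξ` is `√(a² + ξ²)`. [folklore] -/
private theorem norm_negI_mul_add (a ξ : ℝ) : ‖-Complex.I * (a : ℂ) + (ξ : ℂ)‖ = Real.sqrt (a ^ 2 + ξ ^ 2) := by
  rw [Complex.norm_eq_sqrt_sq_add_sq]
  congr 1
  simp [Complex.add_re, Complex.add_im, Complex.mul_re, Complex.mul_im]
  ring

/-- **The shifted free symbol in resolvent form**: `p_θ(k) = βL² / (-i(ω + θ) + ξ)` whenever `(ω+θ)² + ξ² ≠ 0` (e.g.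
`|θ| < |ω|`). [cite: BenfattoGiulianiMastropietro2006, §2.1 (2.3)] -/
theorem shiftedFreeSymbol_eq_div (β μ θ : ℝ) (ks : FreqMomentum L M × Fin 2)
    (h : (matsubaraFreq β M ks.1.1 + θ) ^ 2 + nambuXi L μ ks.1.2 ^ 2 ≠ 0) :
    shiftedFreeSymbol L M β μ θ ks =
      ((β * (L : ℝ) ^ 2 : ℝ) : ℂ) / (-Complex.I * ((matsubaraFreq β M ks.1.1 + θ : ℝ) : ℂ) + (nambuXi L μ ks.1.2 : ℂ)) := by
  rw [shiftedFreeSymbol, resolvent_eq_inv h, ← div_eq_mul_one_div]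

/-- **Differences of the shifted free symbol** (resolvent identity): for any two labels `k, k′` whose denominators do not
vanish, `‖p_θ(k) - p_θ(k′)‖ ≤ βL² (|ω - ω′| + |ξ - ξ′|) / (√((ω+θ)² + ξ²) · √((ω′+θ)² + ξ′²))` — one frequency step `2π/β` or one
momentum step costs an extra inverse power of the denominator (BGM 2006, (2.36aa)). [cite: BenfattoGiulianiMastropietro2006, (2.36aa)] -/
theorem norm_shiftedFreeSymbol_sub_le {β : ℝ} (hβ : 0 ≤ β) (μ θ : ℝ) (ks ks' : FreqMomentum L M × Fin 2)
    (h : 0 < (matsubaraFreq β M ks.1.1 + θ) ^ 2 + nambuXi L μ ks.1.2 ^ 2)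
    (h' : 0 < (matsubaraFreq β M ks'.1.1 + θ) ^ 2 + nambuXi L μ ks'.1.2 ^ 2) :
    ‖shiftedFreeSymbol L M β μ θ ks - shiftedFreeSymbol L M β μ θ ks'‖ ≤
      β * (L : ℝ) ^ 2 * (|matsubaraFreq β M ks.1.1 - matsubaraFreq β M ks'.1.1| + |nambuXi L μ ks.1.2 - nambuXi L μ ks'.1.2|) /
        (Real.sqrt ((matsubaraFreq β M ks.1.1 + θ) ^ 2 + nambuXi L μ ks.1.2 ^ 2) *
          Real.sqrt ((matsubaraFreq β M ks'.1.1 + θ) ^ 2 + nambuXi L μ ks'.1.2 ^ 2)) := by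
  set a : ℝ := matsubaraFreq β M ks.1.1 + θ with ha
  set a' : ℝ := matsubaraFreq β M ks'.1.1 + θ with ha'
  set ξ : ℝ := nambuXi L μ ks.1.2 with hξ
  set ξ' : ℝ := nambuXi L μ ks'.1.2 with hξ'
  set z : ℂ := -Complex.I * (a : ℂ) + (ξ : ℂ) with hz
  set z' : ℂ := -Complex.I * (a' : ℂ) + (ξ' : ℂ) with hz'
  have hzn : ‖z‖ = Real.sqrt (a ^ 2 + ξ ^ 2) := norm_negI_mul_add a ξ
  have hzn' : ‖z'‖ = Real.sqrt (a' ^ 2 + ξ' ^ 2) := norm_negI_mul_add a' ξ'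
  have hz0 : z ≠ 0 := by
    intro h0; have := congrArg norm h0; rw [hzn, norm_zero] at this
    exact (Real.sqrt_pos.2 h).ne' this
  have hz0' : z' ≠ 0 := by
    intro h0; have := congrArg norm h0; rw [hzn', norm_zero] at this
    exact (Real.sqrt_pos.2 h').ne' this
  rw [shiftedFreeSymbol_eq_div β μ θ ks h.ne', shiftedFreeSymbol_eq_div β μ θ ks' h'.ne']
  have hcast : ((matsubaraFreq β M ks.1.1 + θ : ℝ) : ℂ) = (a : ℂ) := by rw [ha]
  have hcast' : ((matsubaraFreq β M ks'.1.1 + θ : ℝ) : ℂ) = (a' : ℂ) := by rw [ha']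
  rw [hcast, hcast', ← hξ, ← hξ', ← hz, ← hz', div_sub_div _ _ hz0 hz0', norm_div, norm_mul, hzn, hzn']
  refine div_le_div_of_nonneg_right ?_ (by positivity)
  -- the numerator: `βL² (z′ - z)` with `‖z′ - z‖ ≤ |a - a′| + |ξ - ξ′|`
  have hnum : ((β * (L : ℝ) ^ 2 : ℝ) : ℂ) * z' - z * ((β * (L : ℝ) ^ 2 : ℝ) : ℂ) = ((β * (L : ℝ) ^ 2 : ℝ) : ℂ) * (z' - z) := by ring
  have hdiff : ‖z' - z‖ ≤ |a - a'| + |ξ - ξ'| := by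
    have e : z' - z = -Complex.I * (((a' - a : ℝ)) : ℂ) + (((ξ' - ξ : ℝ)) : ℂ) := by
      rw [hz, hz']; push_cast; ring
    rw [e]
    calc ‖-Complex.I * (((a' - a : ℝ)) : ℂ) + (((ξ' - ξ : ℝ)) : ℂ)‖
        ≤ ‖-Complex.I * (((a' - a : ℝ)) : ℂ)‖ + ‖(((ξ' - ξ : ℝ)) : ℂ)‖ := norm_add_le _ _
      _ = |a - a'| + |ξ - ξ'| := by
          rw [norm_mul, norm_neg, Complex.norm_I, one_mul, Complex.norm_real, Complex.norm_real, Real.norm_eq_abs,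
            Real.norm_eq_abs, abs_sub_comm a' a, abs_sub_comm ξ' ξ]
  have hω : |a - a'| = |matsubaraFreq β M ks.1.1 - matsubaraFreq β M ks'.1.1| := by
    rw [ha, ha']; congr 1; ring
  rw [hnum, norm_mul, Complex.norm_real, Real.norm_eq_abs, abs_of_nonneg (by positivity), ← hω]
  exact mul_le_mul_of_nonneg_left hdiff (by positivity)

end Literature.MathematicalPhysics.QuantumLattice

end
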